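import Literature.NumberTheory.EllipticCurves.BigRepModuleShapiroLocalConditionsProofs
import Literature.NumberTheory.EllipticCurves.SelmerCocycleLiftUnramifiedFiniteProofs
import Literature.NumberTheory.EllipticCurves.Castella2018.AnticyclotomicSelmer
import Mathlib.NumberTheory.NumberField.Completion.InfinitePlace
import Mathlib.NumberTheory.NumberField.InfinitePlace.TotallyRealComplex
import Mathlib.FieldTheory.IsAlgClosed.Basic
import HarnessLib

/-!
# Shapiro's lemma for `Sel^Σ_𝔮`: the local conditions of `Sel^Σ_𝔮(K, T ⊗ Λ^*)` (`selmerBigDecomp`)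
# and of `Sel^Σ_𝔮(K_∞, A)` (`AcSelmer.selmerOver`) correspond under `Sh(c) = (h ↦ c(h)(0))` — PROVED

Topic `Literature/NumberTheory/EllipticCurves`. Theorems only: no definition, no named fact, no `sorry`, no
instance, no notation. Cell `bsd-stepL`, seat `bsd-stepL-defn-ty1` (g7): module M3, part 2/2 (the
Selmer-level statement on `Γ_K`) of the discharge plan `NOTE-prop323-Shapiro-discharge-plan-imc-p1-g11`
(HOME/imc-p1/g11/) for the named fact `SkinnerUrban2014.prop323_XAc_equiv_XBigDecomp` ([SU14] Prop. 3.2.3);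
the group-theoretic core is `BigRepModuleShapiroLocalConditionsProofs.lean` (part 1/2).

## What is proved

For a number field `K` all of whose infinite places are complex (`IsTotallyComplex K`; the fact's `K` is
imaginary quadratic), a `ℤ_p`-extension `κ` with `H = ker κ = Gal(K̄/K_∞)`, a discrete `p`-primary abelian
group `A` carrying a continuous `Γ_K`-action both as `DistribMulAction` (LEFT, `AcSelmer.selmerOver`) and as a
`ContinuousRep ρ` over `𝒪` (RIGHT, `AnticyclotomicBigGaloisRep κ ρ`) with `ρ g a = g • a`, a continuous
1-cocycle `c` of `M = BigRepModule 𝒪 p A` and the Shapiro cocycle `z = Sh(c)`, `z(h) = c(h)(0)` on `H`: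
* **`oneCocycleClass_mem_selmerBigDecomp_iff`** — `[c] ∈ selmerBigDecomp κ ρ 𝔮 Σ ↔ [z] ∈ AcSelmer.selmerOver H A p 𝔮 Σ`
  (Castella's Def. 2.2 conditions on both sides: strict/trivial at `𝔮`, trivial at the finite `w ∉ Σ`,
  `w ∤ p`, nothing elsewhere). This is the "local conditions" half of [SU14] Prop. 3.2.3 ("That this
  identifies `Sel^Σ_{F_∞}(T)` with `Sel^Σ_F(T ⊗_A Λ_{F,A}(ε_F⁻¹))` then follows from the analysis in 3.1.2");
  with M1/M2a/M2b (bijectivity of `Sh` on `H¹`) and M4-core (`Λ`-linearity) it leaves only the assembly M5.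
* place by place, **`resH1_localMap_eq_zero_iff_forall_conjH1_mem_awayKer`** — `res_{Γ_{K_v} → Γ_K}[c] = 0`
  iff every conjugate `conj_σ [z]`, `σ ∈ Γ_K`, dies on `H ⊓ D_v` (the places of `K_∞` above `v`): the two
  unpackings `resH1_oneCocycleClass_eq_zero_iff` (tree, `SelmerCocycleLiftUnramifiedFiniteProofs`), `resOfLe_conjH1_oneCocycleClass_eq_zero_iff`, the
  conjugation identity `rho_apply_conj_zero` (`conj_σ(Sh c) ∼ ev_{κ σ}(c)`) and part 1's
  `exists_eq_bigRep_sub_comp_iff`;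
* **`strictKer_strictDatum_eq_awayKer`** — for Castella's strict datum `M⁺_𝔮 = 0` Greenberg's strict
  condition IS "dies on `H ⊓ D_𝔮`" (the map `M → M ⧸ 0` is injective), so `𝔮` is a place like the others;
* **`decompInf_eq_bot_of_isComplex`**, **`mem_infKer_of_isComplex`** — at a complex place `D_w = 1`, so the
  LEFT-hand condition at infinity is vacuous (the RIGHT has none) — re-homed from the `Summits/` file
  `X11b/AnticyclotomicInfinitePlaces.lean` (x11b3), which `Literature/` cannot import.

HONEST FRAMING: nothing is asserted about finite generation, torsion or main conjectures; the named fact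
`prop323_…` is NOT discharged by this file (M5 assembles).

References: [SkinnerUrban2014] §3.1.2 ((3.1.2.a)–(3.1.2.b), pp. 17–18) and Prop. 3.2.3 with its proof
(pp. 21–22); [Castella2018] Def. 2.2 (p. 4); [Greenberg1989] §1 p. 98 (strict condition); [GreenbergLNM1716]
§3 p. 87 (archimedean primes split completely); [SerreGaloisCohomology1997] I §2.4–2.5, I §5.1.
-/

noncomputable section

open scoped Classical

open NumberField IsDedekindDomain Field Multiplicative
open Literature.NumberTheory.EllipticCurves Literature.NumberTheory.EllipticCurves.GreenbergSelmer
open Literature.NumberTheory.GaloisRepresentations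

universe u

namespace Literature.NumberTheory.EllipticCurves.BigGaloisRep

/-! ## §1 Unpacking restriction maps on explicit cocycles -/

section Unpack

variable {G : Type u} [Group G] [TopologicalSpace G] [IsTopologicalGroup G]
variable {G' : Type u} [Group G'] [TopologicalSpace G'] [IsTopologicalGroup G']
variable {N : Type u} [AddCommGroup N] [DistribMulAction G N] [TopologicalSpace N] [DiscreteTopology N]
variable {N' : Type u} [AddCommGroup N'] [DistribMulAction G' N'] [TopologicalSpace N']
  [DiscreteTopology N']

/-- `res_{(φ, ψ)} [f] = [ψ ∘ f ∘ φ]` on explicit cocycles (Mathlib `map_oneCocycleClass`; the tree's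
`resH1Hom_oneCocycleClass` of `PeriodIndexCorestrictionLocal`, not imported here). [folklore] -/
private theorem resH1Hom_oneCocycleClass_eq (φ : G' →ₜ* G) (ψ : N →+ N')
    (h : ∀ (x : G') (m : N), ψ (φ x • m) = x • ψ m) (f : contOneCocycles (discreteTopRep G N)) :
    resH1Hom φ ψ h (oneCocycleClass (discreteTopRep G N) f) =
      oneCocycleClass (discreteTopRep G' N')
        (contOneCocycles.pullback φ (resHomOfEquivariant φ ψ h) f) :=
  map_oneCocycleClass (X := discreteTopRep G N) (Y := discreteTopRep G' N') φ
    (resHomOfEquivariant φ ψ h) f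

/-- **Cocycle criterion for `res ∘ conj_σ`**: for a normal `H ≤ G`, `H₁ ≤ H`, `σ ∈ G` and a cocycle
`z` of `H`, the class `res_{H₁}(conj_σ [z])` vanishes iff `x ↦ σ • z(σ⁻¹ x σ)` is principal on `H₁`.
[cite: SerreGaloisCohomology1997, I §5.1 and I §2.5 (conjugation on `H¹(H, ·)`)] -/
theorem resOfLe_conjH1_oneCocycleClass_eq_zero_iff {H H₁ : Subgroup G} [H.Normal] (h : H₁ ≤ H)
    (σ : G) (z : contOneCocycles (discreteTopRep H N)) :
    resOfLe N h (conjH1 H N σ (oneCocycleClass _ z)) = 0 ↔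
      ∃ a : N, ∀ x : H₁, σ • z.1 (subgroupConj H σ (subgroupInclusion h x)) = (x : G) • a - a := by
  rw [conjH1, resH1Hom_oneCocycleClass_eq, resOfLe, resH1Hom_oneCocycleClass_eq,
    oneCocycleClass_eq_zero_iff]
  rfl

end Unpack

/-! ## §2 The strict condition at `𝔮` for `M⁺_𝔮 = 0`; complex places -/

section Places

variable {K : Type u} [Field K] [NumberField K]
variable (H : Subgroup (absoluteGaloisGroup K)) (M : Type u) [AddCommGroup M]
  [DistribMulAction (absoluteGaloisGroup K) M] [TopologicalSpace M] [DiscreteTopology M]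

/-- **For Castella's strict datum `M⁺_𝔮 = 0`, Greenberg's strict condition at `𝔮` is `awayKer`**: the
coefficient map `M → M ⧸ 0` is injective and `D_𝔮`-equivariant, so a class dies in `H¹(H ⊓ D_𝔮, M ⧸ 0)`
iff it dies in `H¹(H ⊓ D_𝔮, M)` ("`0` if `w = 𝔭`": the place `𝔮` carries the same trivial-class
condition as the finite `w ∉ Σ`). [cite: Greenberg1989, §1 p. 98 (the strict condition)] [cite: Castella2018, Def. 2.2 (p. 4, "`0` if `w = 𝔭`")] -/
theorem strictKer_strictDatum_eq_awayKer (v : HeightOneSpectrum (𝓞 K)) :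
    (Castella2018.AcSelmer.strictDatum M v).strictKer H = awayKer H M v := by
  ext c
  obtain ⟨φ, rfl⟩ := oneCocycleClass_surjective _ c
  rw [LocalDatum.mem_strictKer_iff, LocalDatum.strictMap, resH1Hom_oneCocycleClass_eq,
    oneCocycleClass_eq_zero_iff, awayKer, AddMonoidHom.mem_ker, resOfLe, resH1Hom_oneCocycleClass_eq,
    oneCocycleClass_eq_zero_iff]
  constructor
  · rintro ⟨tbar, htbar⟩
    obtain ⟨t, rfl⟩ := (Castella2018.AcSelmer.strictDatum M v).grMk_surjective tbar
    refine ⟨t, fun g ↦ ?_⟩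
    have hg := Subgroup.mem_inf.1 g.2
    have h1 := htbar ⟨⟨(g : absoluteGaloisGroup K), hg.2⟩, (mem_decompIn_iff H v _).2 hg.1⟩
    have h2 : (Castella2018.AcSelmer.strictDatum M v).grMk (φ.1 ⟨g, hg.1⟩) =
        (Castella2018.AcSelmer.strictDatum M v).grMk ((g : absoluteGaloisGroup K) • t - t) := by
      rw [map_sub]
      exact h1
    rw [← sub_eq_zero, ← map_sub, ← AddMonoidHom.mem_ker, LocalDatum.ker_grMk] at h2
    change _ ∈ (⊥ : AddSubgroup M) at h2
    rw [AddSubgroup.mem_bot, sub_eq_zero] at h2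
    exact h2
  · rintro ⟨t, ht⟩
    refine ⟨(Castella2018.AcSelmer.strictDatum M v).grMk t, fun g ↦ ?_⟩
    have hgD : ((g : decomp (K := K) v) : absoluteGaloisGroup K) ∈ decomp v := (g : decomp v).2
    have hgH : ((g : decomp (K := K) v) : absoluteGaloisGroup K) ∈ H := (mem_decompIn_iff H v _).1 g.2
    have h1 := ht ⟨((g : decomp (K := K) v) : absoluteGaloisGroup K), Subgroup.mem_inf.2 ⟨hgH, hgD⟩⟩
    change (Castella2018.AcSelmer.strictDatum M v).grMk (φ.1 (decompInToH H v g)) =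
      (g : decomp (K := K) v) • (Castella2018.AcSelmer.strictDatum M v).grMk t -
        (Castella2018.AcSelmer.strictDatum M v).grMk t
    rw [LocalDatum.smul_grMk, ← map_sub]
    exact congrArg _ h1

omit [NumberField K] in
/-- `Γ_F` is trivial for `F` algebraically closed (`F → F̄` is onto). [folklore] -/
private theorem subsingleton_absoluteGaloisGroup_of_isAlgClosed (F : Type u) [Field F] [IsAlgClosed F] :
    Subsingleton (absoluteGaloisGroup F) := by
  refine ⟨fun σ τ ↦ AlgEquiv.ext fun x ↦ ?_⟩
  obtain ⟨y, rfl⟩ :=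
    (IsAlgClosed.algebraMap_bijective_of_isIntegral (k := F) (K := AlgebraicClosure F)).2 x
  rw [AlgEquiv.commutes, AlgEquiv.commutes]

omit [NumberField K] in
/-- **At a complex place the decomposition group is trivial**: `K_w ≃ ℂ` is algebraically closed, so
`Γ_{K_w} = 1` and its image `D_w ≤ Γ_K` is `⊥` ("the archimedean primes of `F` split completely in
`F_∞/F`"). Re-homed from x11b3's `Summits/…/X11b/AnticyclotomicInfinitePlaces.lean`.
[cite: GreenbergLNM1716, §3 p. 87 (archimedean primes split completely)] -/
theorem decompInf_eq_bot_of_isComplex {w : InfinitePlace K} (hw : w.IsComplex) : decompInf w = ⊥ := by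
  -- `K_w ≃ ℂ` is algebraically closed (Mathlib `IsAlgClosed.of_ringEquiv`, across universes)
  haveI : IsAlgClosed w.Completion := by
    let e : ℂ ≃+* w.Completion := (InfinitePlace.Completion.ringEquivComplexOfIsComplex hw).symm
    refine IsAlgClosed.of_exists_root _ fun q hmq hq ↦ ?_
    have hqe : (q.map e.symm.toRingHom).degree ≠ 0 := by
      rw [Polynomial.degree_map]
      exact ne_of_gt (Polynomial.degree_pos_of_irreducible hq)
    obtain ⟨x, hx⟩ := IsAlgClosed.exists_root (k := ℂ) (q.map e.symm.toRingHom) hqe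
    refine ⟨e x, ?_⟩
    rw [Polynomial.IsRoot] at hx
    apply e.symm.injective
    rw [map_zero, ← hx]
    clear hx hqe hq hmq
    induction q using Polynomial.induction_on <;> simp_all
  haveI := subsingleton_absoluteGaloisGroup_of_isAlgClosed w.Completion
  rw [eq_bot_iff]
  rintro g ⟨σ, rfl⟩
  rw [Subsingleton.elim σ 1, map_one]
  exact (⊥ : Subgroup (absoluteGaloisGroup K)).one_mem

omit [NumberField K] in
/-- **Complex places impose nothing**: at a complex `w`, `H ⊓ D_w = 1` and `H¹(1, M) = 0`, so every class
of `H¹(H, M)` lies in `infKer H M w`. [cite: GreenbergLNM1716, §3 p. 87 (archimedean primes split completely)] -/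
theorem mem_infKer_of_isComplex {w : InfinitePlace K} (hw : w.IsComplex) (c : subgroupH1 H M) :
    c ∈ infKer H M w := by
  rw [infKer, AddMonoidHom.mem_ker]
  obtain ⟨ψ, hψ⟩ := oneCocycleClass_surjective _ (resOfLe M (inf_le_left : H ⊓ decompInf w ≤ H) c)
  rw [← hψ]
  have h0 : ψ = 0 := by
    apply Subtype.ext
    ext x
    have hx : x = 1 := by
      apply Subtype.ext
      have h : (x : absoluteGaloisGroup K) ∈ (⊥ : Subgroup (absoluteGaloisGroup K)) := by
        rw [← decompInf_eq_bot_of_isComplex hw]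
        exact (Subgroup.mem_inf.mp x.2).2
      exact Subgroup.mem_bot.mp h
    rw [hx]
    exact contOneCocycles.apply_one ψ
  rw [h0, oneCocycleClass_zero]

end Places

/-! ## §3 Place by place: `res_{D_v}[c] = 0 ↔ ∀ σ, conj_σ [Sh c]` dies on `H ⊓ D_v` -/

section Local

variable {K : Type u} [Field K] [NumberField K] {p : ℕ} [Fact p.Prime]
variable {𝒪 : Type*} [CommRing 𝒪] [TopologicalSpace 𝒪]
variable {A : Type u} [AddCommGroup A] [Module 𝒪 A] [DistribMulAction (absoluteGaloisGroup K) A]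
  [TopologicalSpace A] [DiscreteTopology A]
variable [TopologicalSpace (PowerSeries 𝒪)] [ContinuousSMul (PowerSeries 𝒪) (BigRepModule 𝒪 p A)]
variable (κ : ZpExtension K p) (ρ : ContinuousRep (absoluteGaloisGroup K) 𝒪 A)
  (hρ : ∀ (g : absoluteGaloisGroup K) (a : A), ρ g a = g • a)
  (hA : ∀ a : A, ∃ k : ℕ, p ^ k • a = 0)
  (c : contOneCocycles (AnticyclotomicBigGaloisRep κ ρ).toTopRep)
  (z : contOneCocycles (discreteTopRep κ.kerSubgroup A))
  (hz : ∀ h : κ.kerSubgroup, z.1 h = (c.1 (h : absoluteGaloisGroup K) : BigRepModule 𝒪 p A) 0)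

include hρ hA hz

/-- **The local condition at a finite place `v`, both formulations.** The class of the continuous
1-cocycle `c` of `T ⊗ Λ^*` dies in `H¹(K_v, T ⊗ Λ^*)` (restriction along `Γ_{K_v} → Γ_K`, the RIGHT-hand
condition `resH1 … (localMap K (Sum.inl v)) [c] = 0`) iff every `Γ_K`-conjugate of the Shapiro class
`[Sh c] ∈ H¹(K_∞, A)` dies at the chosen place of `K_∞` above `v` (`conj_σ [z] ∈ awayKer (ker κ) A v` for
all `σ`: the LEFT-hand conditions at all places of `K_∞` above `v`). Proof: unpack both sides on cocycles,
turn `σ • z(σ⁻¹xσ) = ρ σ (c(σ⁻¹xσ)(0))` into the evaluation `c(x)(κ σ)` up to a coboundary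
(`rho_apply_conj_zero`), use surjectivity of `κ`, and conclude by part 1's `exists_eq_bigRep_sub_comp_iff`
for the compact group `Γ_{K_v}`. [cite: SkinnerUrban2014, §3.1.2 ((3.1.2.a)–(3.1.2.b), pp. 17–18: "the bottom isomorphism of (3.1.2.b) identifies `H¹(k_v, Ind M)` with `∏_{w∣v} H¹(E_w, M)`") and Prop. 3.2.3 (proof, p. 22)] -/
theorem resH1_localMap_eq_zero_iff_forall_conjH1_mem_awayKer (v : HeightOneSpectrum (𝓞 K)) :
    resH1 (AnticyclotomicBigGaloisRep κ ρ) (localMap K (Sum.inl v)) (oneCocycleClass _ c) = 0 ↔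
      ∀ σ : absoluteGaloisGroup K,
        conjH1 κ.kerSubgroup A σ (oneCocycleClass _ z) ∈ awayKer κ.kerSubgroup A v := by
  haveI : CharZero (v.adicCompletion K) :=
    charZero_of_injective_algebraMap (algebraMap K (v.adicCompletion K)).injective
  haveI : CompactSpace (LocalGroup K (Sum.inl v)) :=
    inferInstanceAs (CompactSpace (absoluteGaloisGroup (v.adicCompletion K)))
  have hc : ∀ g h : absoluteGaloisGroup K, (c.1 (g * h) : BigRepModule 𝒪 p A) =
      c.1 g + bigRep κ.toContinuousMonoidHom ρ g (c.1 h) := fun g h ↦ c.2 g h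
  rw [resH1_oneCocycleClass_eq_zero_iff,
    BigRepModule.exists_eq_bigRep_sub_comp_iff κ.toContinuousMonoidHom ρ (localMap K (Sum.inl v)) hA
      c.1.continuous hc]
  constructor
  · intro h σ
    rw [awayKer, AddMonoidHom.mem_ker, resOfLe_conjH1_oneCocycleClass_eq_zero_iff]
    obtain ⟨a, ha⟩ := h (κ.toContinuousMonoidHom σ).toAdd
    refine ⟨a + (c.1 σ : BigRepModule 𝒪 p A) (κ.toContinuousMonoidHom σ).toAdd, fun x ↦ ?_⟩
    have hxH : κ.toContinuousMonoidHom (x : absoluteGaloisGroup K) = 1 :=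
      ZpExtension.mem_kerSubgroup.1 (Subgroup.mem_inf.1 x.2).1
    obtain ⟨τ, hτ⟩ := (mem_decomp_iff v _).1 (Subgroup.mem_inf.1 x.2).2
    have hax := ha τ (by rw [show localMap K (Sum.inl v) τ = x from hτ]; exact hxH)
    rw [show localMap K (Sum.inl v) τ = x from hτ] at hax
    simp only [hz, subgroupConj_apply_coe, subgroupInclusion_apply_coe, ← hρ]
    rw [BigRepModule.rho_apply_conj_zero κ.toContinuousMonoidHom ρ hc σ hxH, hax, map_add]
    abel
  · intro h y
    obtain ⟨σ, hσ⟩ := κ.surjective (ofAdd y)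
    have hσy : (κ.toContinuousMonoidHom σ).toAdd = y := by rw [hσ, toAdd_ofAdd]
    have hσv := h σ
    rw [awayKer, AddMonoidHom.mem_ker, resOfLe_conjH1_oneCocycleClass_eq_zero_iff] at hσv
    obtain ⟨a, ha⟩ := hσv
    refine ⟨a - (c.1 σ : BigRepModule 𝒪 p A) y, fun τ hτ ↦ ?_⟩
    have hx : localMap K (Sum.inl v) τ ∈ κ.kerSubgroup ⊓ decomp v :=
      Subgroup.mem_inf.2 ⟨ZpExtension.mem_kerSubgroup.2 hτ, (mem_decomp_iff v _).2 ⟨τ, rfl⟩⟩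
    have h1 := ha ⟨localMap K (Sum.inl v) τ, hx⟩
    simp only [hz, subgroupConj_apply_coe, subgroupInclusion_apply_coe, ← hρ] at h1
    rw [BigRepModule.rho_apply_conj_zero κ.toContinuousMonoidHom ρ hc σ hτ, hσy] at h1
    rw [map_sub (ρ (localMap K (Sum.inl v) τ))]
    calc (c.1 (localMap K (Sum.inl v) τ) : BigRepModule 𝒪 p A) y
        = (ρ (localMap K (Sum.inl v) τ) a - a) -
            (ρ (localMap K (Sum.inl v) τ) ((c.1 σ : BigRepModule 𝒪 p A) y) -
              (c.1 σ : BigRepModule 𝒪 p A) y) := by rw [← h1]; abel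
      _ = _ := by abel

/-! ## §4 The Selmer groups correspond -/

/-- **LOCAL CONDITIONS UNDER SHAPIRO, Selmer level ([SU14] Prop. 3.2.3, "the analysis in 3.1.2").**
For `K` totally complex (e.g. imaginary quadratic), a `ℤ_p`-extension `κ` with `H = Gal(K̄/K_∞)`, a discrete
`p`-primary `Γ_K`-module `A` (`ρ g a = g • a`), a continuous 1-cocycle `c` of `T ⊗ Λ^*(Ψ⁻¹) = BigRepModule 𝒪 p A`
and its Shapiro cocycle `z = Sh(c)`, `z(h) = c(h)(0)` on `H`: **`[c] ∈ Sel^Σ_𝔮(K, T ⊗ Λ^*)`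
(`selmerBigDecomp κ ρ 𝔮 Σ`, Castella's Def. 2.2 strict set: trivial at `𝔮` and at every finite `w ∉ Σ`,
`w ∤ p`) iff `[z] ∈ Sel^Σ_𝔮(K_∞, A)` (`AcSelmer.selmerOver H A p 𝔮 Σ`: strict at `𝔮`, locally trivial above
the finite `w ∉ Σ`, `w ∤ p`, and at the infinite places — vacuous, `K` being totally complex)**. Place by
place this is `resH1_localMap_eq_zero_iff_forall_conjH1_mem_awayKer`; at `𝔮` the strict condition for
`M⁺_𝔮 = 0` is the trivial-class condition (`strictKer_strictDatum_eq_awayKer`). No hypothesis on `𝔮`, `Σ`,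
`p` beyond the shapes (in the fact: `p = 𝔮𝔮̄` split, `Σ` finite away from `p`).
[cite: SkinnerUrban2014, Prop. 3.2.3 (pp. 21–22: "That this identifies `Sel^Σ_{F_∞}(T)` with `Sel^Σ_F(T ⊗_A Λ_{F,A}(ε_F⁻¹))` then follows from the analysis in 3.1.2") with §3.1.2 ((3.1.2.a)–(3.1.2.b))]
[cite: Castella2018, Def. 2.2 (p. 4)] -/
theorem oneCocycleClass_mem_selmerBigDecomp_iff [IsTotallyComplex K] (𝔮 : HeightOneSpectrum (𝓞 K))
    (S : Set (HeightOneSpectrum (𝓞 K))) :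
    oneCocycleClass _ c ∈ selmerBigDecomp κ ρ 𝔮 S ↔
      oneCocycleClass _ z ∈ Castella2018.AcSelmer.selmerOver κ.kerSubgroup A p 𝔮 S := by
  rw [selmerBigDecomp, mem_selmer_iff, Castella2018.AcSelmer.mem_selmerOver_iff]
  constructor
  · intro h
    refine ⟨fun v hv hvS σ ↦ ?_, fun w σ ↦ ?_, fun σ ↦ ?_⟩
    · exact (resH1_localMap_eq_zero_iff_forall_conjH1_mem_awayKer κ ρ hρ hA c z hz v).1
        (h (Sum.inl v) ((inl_mem_strictSetDecomp_iff p 𝔮 v S).2 (Or.inr ⟨hvS, hv⟩))) σ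
    · exact mem_infKer_of_isComplex κ.kerSubgroup A (IsTotallyComplex.isComplex w) _
    · rw [strictKer_strictDatum_eq_awayKer]
      exact (resH1_localMap_eq_zero_iff_forall_conjH1_mem_awayKer κ ρ hρ hA c z hz 𝔮).1
        (h (Sum.inl 𝔮) ((inl_mem_strictSetDecomp_iff p 𝔮 𝔮 S).2 (Or.inl rfl))) σ
  · rintro ⟨haway, -, hstrict⟩ (w | w) hw
    · rcases (inl_mem_strictSetDecomp_iff p 𝔮 w S).1 hw with hw𝔮 | ⟨hwS, hwp⟩
      · rw [hw𝔮]
        refine (resH1_localMap_eq_zero_iff_forall_conjH1_mem_awayKer κ ρ hρ hA c z hz 𝔮).2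
          fun σ ↦ ?_
        rw [← strictKer_strictDatum_eq_awayKer]
        exact hstrict σ
      · exact (resH1_localMap_eq_zero_iff_forall_conjH1_mem_awayKer κ ρ hρ hA c z hz w).2
          (haway w hwp hwS)
    · exact (inr_not_mem_strictSetDecomp p 𝔮 w S hw).elim

end Local

end Literature.NumberTheory.EllipticCurves.BigGaloisRep

end
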